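import Summits.BirchSwinnertonDyer.BirchSwinnertonDyer.Theorems.ThetaPartnerAtTwoSignedKatoUpToAtTwoColGlue
import Summits.BirchSwinnertonDyer.BirchSwinnertonDyer.Theorems.ThetaPartnerAtTwoSignedKatoUpToAtTwoRecInterface
import Summits.BirchSwinnertonDyer.BirchSwinnertonDyer.Theorems.ThetaPartnerAtTwoSignedKatoUpToAtTwoPointsLocalCover
import Summits.BirchSwinnertonDyer.Rank1Residual.Supersingular.KobayashiMainConjecture
import Literature.NumberTheory.EllipticCurves.Kato2004.EulerSystemBoundFineSelmerTwo
import Literature.NumberTheory.EllipticCurves.IwasawaAlgebraInvolution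
import HarnessLib

/-!
# Route `ThetaPartnerAtTwo` (TP2), crux K3 `SignedKatoDivisibilityUpToAtTwo` (item stmt-BirchSwinnertonDyer-20308),
# line `colemanrat` v5 — (R2^ι) `stub_localRobustPackageTwoInv` FROM «the points package ∧ the residue IN POINTS CURRENCY»

Width seat `bsd-wall-tp2-p2x-w2` g3 (cell `bsd-wall`). HONEST FRAMING: THEOREMS ONLY — no definition, no named fact, no
instance, no `sorry`; route-independent (no `Theses`/`Cruxes` import: the registered stub text is written out verbatim as the
CONCLUSION); closes no item; the hypothesis carries ALL the research content (the `T₂E`-adic local Tate pairing along the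
`ℤ₂`-tower, Poitou–Tate along `ℚ_∞`, Kato's explicit reciprocity at `2`). BSD is NOT proved by any of this.

## What is proved

`localRobustPackageTwoInv_of_pointsPackage_of_residue` — a PLUMBING CERTIFICATE. Its hypothesis asks, per place `v ∋ 2`, habitat
datum, pinned plus dual `D` (torsion) and height-one `𝔭 ∌ 2`, for
* a local lift `g` of the generator (`κ(res g) = 1`), a system `d` of local points, a points-model `j₀` on `A⁺ = ⨆ₙ E⁺(ℚ_n·ℚ_v)`
  WITH ITS KUMMER VALUE FORMULA (the shape of `KummerPoint.exists_pointsModelJ_two`) and an exponent `m`;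
* (PKG) the ∃-conclusion of the lead's `KummerPoint.exists_pointsPackage_two` VERBATIM (`P`, `ι_P` injective, `q` onto and
  `Λ`-compatible for `Sprung2012.lambdaSMul`, `ι_P ∘ q = Col♭` via `IsColemanPair κ ι W 0 g d`, `j ∘ q = j₀ ∘ res_{A⁺}`,
  `j` ι-semilinear, local cover with exponent `0`);
* (RES) **the research residue in points currency** for the same `(g, d)`: a pinned `I = 𝐇¹_Γ(T₂E)` and a family of
  `ℤ₂`-linear LAYER PAIRINGS `pair n : H¹(ℚ_n, T₂E) → Hom(E(ℚ_n·ℚ_v), ℤ₂)` with (P1) the projection formula, (P2) Galois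
  invariance for `g`, (PT) ORTHOGONALITY up to `2^m` on Kummer witnesses of `Sel⁺(E/ℚ_∞)`-classes
  («`2^m·⟨proj n x, 2^k Q⟩_n ∈ 2^k ℤ₂`», what Poitou–Tate along `ℚ_∞` must output), and (ES+Z) a genuine `2`-adic
  Euler-system class `s` whose glued functional `z = col₀ s` has a Coleman pair `(Ls, Lf)` with `ℓ_𝔭(Λ/(Lf)) ≤ ℓ_𝔭(Λ/(L♭))`
  (what the explicit reciprocity law at `2` must output);
and concludes the REGISTERED stub (R2^ι) `Cruxes.SignedKatoDivisibilityUpToAtTwo.ColemanRat.stub_localRobustPackageTwoInv`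
VERBATIM. Proof = `ColGlue.exists_col_linear` (glue `col₀`, `Λ`-compatibility), `RecInterface.exists_linearMap_comp_of_lambdaSMul`
(`col := q ∘ col₀`), `RecInterface.pointsModelJ_nsmul_eq_zero_of_forall_witness` ((Rec) from (PT)), `ColGlue.col_unique`-style
identification `z = col₀ s` ((Z) through `ι_P (q z) = Lf`), and `IwasawaAlgebra.invol_C` (the cover with exponent `m`).
So: «P-side (kernel, lead) ∧ RES ⇒ R2^ι», and RES is a candidate promote text for the crux's research residue in the currency
of the sources (Perrin-Riou's `Λ`-adic pairing, Kobayashi (8.23)/(7.17), Kato Thm. 12.5 / Sprung Def. 6.1).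

References: [Kobayashi2003] Thm. 6.2–6.3, (7.17)–(7.21), (8.23); [Kato2004Asterisque] §12.2, Thm. 12.5, §17.13; [Sprung2012]
Def. 5.9, Def. 6.1, Def. 7.9; [PerrinRiou1994Invent] §3.6.1; [MilneADT2006] Ch. I Thm. 4.10.
-/

set_option autoImplicit false
-- the Theorems namespace of this sub repeats the summit name by design (D-0017 nested layout)
set_option linter.dupNamespace false

noncomputable section

open scoped Classical MatrixGroups ModularForm NumberField

namespace Summit.BirchSwinnertonDyer.BirchSwinnertonDyer.Theorems

namespace SignedKatoOffTwo.PackageOfResidue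

open CongruenceSubgroup WeierstrassCurve Field IsDedekindDomain NumberField
  Literature.NumberTheory.GaloisRepresentations
  Literature.NumberTheory.EllipticCurves Literature.NumberTheory.EllipticCurves.ModularForms
  Literature.NumberTheory.EllipticCurves.Module Literature.NumberTheory.EllipticCurves.Rank1Residual
  Literature.NumberTheory.EllipticCurves.Kobayashi2003 Literature.NumberTheory.EllipticCurves.Kato2004
  Literature.NumberTheory.EllipticCurves.Kato2004.EulerSystemValues Literature.NumberTheory.EllipticCurves.GreenbergSelmer
  Literature.NumberTheory.EllipticCurves.Sprung2012
  ZpExtension Summit.BirchSwinnertonDyer.Rank1Residual.Supersingular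

/-- `C(2)^m • x = 2^m • x` in any `Λ`-module. [folklore] -/
theorem C_two_pow_smul_eq_nsmul {X : Type*} [AddCommGroup X] [_root_.Module (IwasawaAlgebra 2) X] (m : ℕ) (x : X) :
    (PowerSeries.C (2 : ℤ_[2]) : IwasawaAlgebra 2) ^ m • x = 2 ^ m • x := by
  have h : (PowerSeries.C (2 : ℤ_[2]) : IwasawaAlgebra 2) ^ m = ((2 ^ m : ℕ) : IwasawaAlgebra 2) := by
    rw [Nat.cast_pow, Nat.cast_ofNat, map_ofNat]
  rw [h, Nat.cast_smul_eq_nsmul]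

/-- `ι (C(2)^m) = C(2)^m` for the Iwasawa involution `ι = IwasawaAlgebra.invol 2`. [cite: MazurTateTeitelbaum1986Invent, Ch. I §17] -/
theorem invol_C_two_pow (m : ℕ) :
    IwasawaAlgebra.invol 2 ((PowerSeries.C (2 : ℤ_[2]) : IwasawaAlgebra 2) ^ m) =
      (PowerSeries.C (2 : ℤ_[2]) : IwasawaAlgebra 2) ^ m := by
  rw [map_pow, IwasawaAlgebra.invol_C]

/-- **(R2^ι) FROM THE POINTS PACKAGE AND THE RESIDUE IN POINTS CURRENCY.** For every place `v ∋ 2`, habitat datum, pinned plus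
dual `D` (torsion) and height-one `𝔭 ∌ 2`, assume: a local lift `g` (`κ(res g) = 1`), a system of local points `d`, a points-model
`j₀ : Hom(A⁺, ℤ₂) → X⁺` with its Kummer value formula, an exponent `m`, (PKG) the ∃-conclusion of `KummerPoint.exists_pointsPackage_two`
verbatim, and (RES) a pinned `I`, layer pairings `pair n : H¹(ℚ_n, T₂E) →ₗ[ℤ₂] Hom(E(ℚ_n·ℚ_v), ℤ₂)` with (P1) projection formula,
(P2) invariance for `g`, (PT) orthogonality up to `2^m` on the Kummer witnesses of the classes of `Sel⁺(E/ℚ_∞)`, and (ES+Z) a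
genuine `2`-adic Euler-system class `s`, its glued functional `z` (`z|_{E_n} = ⟨proj n s, ·⟩_n`), a Coleman pair `(Ls, Lf)` of `z`
for `(g, d)` with `ℓ_𝔭(Λ/(Lf)) ≤ ℓ_𝔭(Λ/(L♭))`. THEN the registered stub (R2^ι) `stub_localRobustPackageTwoInv` holds verbatim:
witnesses `I`, `P`, `ι_P`, `col := q ∘ col₀` (`col₀` the glue of the pairings, `Λ`-linear: `ColGlue.exists_col_linear`,
`RecInterface.exists_linearMap_comp_of_lambdaSMul`), `j`, `s`, `m`; (Col) from `ι_P` injective; (Rec) `C(2)^m • j (col x) = 0` from (PT)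
(`RecInterface.pointsModelJ_nsmul_eq_zero_of_forall_witness`, every Selmer class has a witness); (LocCover) with exponent `m` from
exponent `0` and `ι(C 2) = C 2`; (Z) from `z = col₀ s` (uniqueness of the glue) and `ι_P (q z) = Lf`.
[cite: Kobayashi2003, Thm. 6.2–6.3 (p. 11), (7.17)–(7.21) (pp. 12–13), (8.23)] [cite: Kato2004Asterisque, §12.2 (p. 220), Thm. 12.5 (p. 222), §17.13 (p. 279)]
[cite: Sprung2012, Def. 5.9 (p. 1495), Def. 6.1, Def. 7.9 (p. 1503)] [cite: PerrinRiou1994Invent, §3.6.1] [cite: MilneADT2006, Ch. I, Thm. 4.10] -/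
theorem localRobustPackageTwoInv_of_pointsPackage_of_residue
    (H : ∀ (v : HeightOneSpectrum (𝓞 ℚ)), ((2 : ℕ) : 𝓞 ℚ) ∈ v.asIdeal →
      ∀ (W : WeierstrassCurve ℚ) [W.IsElliptic] [W.IsGloballyMinimal],
        ¬ W.HasCM → W.analyticRank = 0 → GoodSS W 2 → W.frobeniusTrace 2 = 0 →
        ∀ (κ : ZpExtension ℚ 2) (γ : Field.absoluteGaloisGroup ℚ) (hκ : κ.IsCyclotomic),
          κ.IsTopGenerator γ → IsCyclotomicVariable 2 γ →
          ∀ [NeZero (W.conductorNorm ℤ)] (f : CuspForm (Gamma0 (W.conductorNorm ℤ)) 2),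
            IsNewformOf W f → ∀ (ϖ : ℚ), (ϖ : ℝ) * W.realPeriodRat = plusPeriod f →
          ∀ (Lplus Lminus : IwasawaAlgebra 2), IsPollackPair f 2 Lplus Lminus →
          ∀ (D : SignedSelmerDualData W κ γ 1) [ContinuousSMul ℤ_[2] (W.tateModule 2)]
            [Module.Free ℤ_[2] (W.tateModule 2)] [Module.Finite ℤ_[2] (W.tateModule 2)],
            Module.IsTorsion (IwasawaAlgebra 2) D.X →
            ∀ 𝔭 : PrimeSpectrum (IwasawaAlgebra 2), 𝔭.asIdeal.height = 1 →
              PowerSeries.C (2 : ℤ_[2]) ∉ 𝔭.asIdeal →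
            ∃ (g : absoluteGaloisGroup (v.adicCompletion ℚ))
              (hg : κ.IsTopGenerator (resGalOfEmb (closureEmb (K := ℚ) (v.adicCompletion ℚ)) g))
              (d : ℕ → localPoints W (v.adicCompletion ℚ))
              (j₀ : (↥(⨆ n, signedLocalPoints κ (v.adicCompletion ℚ) W 1 n) →+ ℤ_[2]) →+ D.X) (m : ℕ),
              -- the Kummer value formula of `j₀` (shape of `KummerPoint.exists_pointsModelJ_two`)
              (∀ (φA : ↥(⨆ n, signedLocalPoints κ (v.adicCompletion ℚ) W 1 n) →+ ℤ_[2])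
                  (s : W.subgroupH1 2 κ.kerSubgroup) (hs : s ∈ signedSelmerInfty W κ 1)
                  (φ : contOneCocycles (discreteTopRep κ.kerSubgroup (W.geomPrimaryTorsion 2)))
                  (Q : localPoints W (v.adicCompletion ℚ)) (k : ℕ)
                  (_ : oneCocycleClass _ φ = s) (hQ : 2 ^ k • Q ∈ (⨆ n, signedLocalPoints κ (v.adicCompletion ℚ) W 1 n))
                  (_ : ∀ τ : localSubgroupOfEmb κ.kerSubgroup (closureEmb (K := ℚ) (v.adicCompletion ℚ)),
                    pointsMapOfEmb W (closureEmb (K := ℚ) (v.adicCompletion ℚ))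
                        ((φ.1 (resGalSubgroupOfEmb κ.kerSubgroup _ τ) : W.geomPrimaryTorsion 2) : W.geomPoints) =
                      (τ : absoluteGaloisGroup (v.adicCompletion ℚ)) • Q - Q),
                  D.toDual (j₀ φA) ⟨s, hs⟩ =
                    (PadicInt.toZModPow k (φA ⟨2 ^ k • Q, hQ⟩)).val • ((((2 : ℚ) ^ k)⁻¹ : ℚ) : AddCircle (1 : ℚ))) ∧
              -- (PKG) the points package (`KummerPoint.exists_pointsPackage_two`, verbatim shape)
              (∃ (P : Type) (_ : AddCommGroup P) (_ : _root_.Module (IwasawaAlgebra 2) P)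
                  (ιP : P →ₗ[IwasawaAlgebra 2] IwasawaAlgebra 2)
                  (q : (localTowerPointsOfEmb κ (closureEmb (K := ℚ) (v.adicCompletion ℚ)) W →+ ℤ_[2]) →+ P) (j : P →+ D.X),
                  Function.Injective ιP ∧ Function.Surjective q ∧
                  (∀ (f : IwasawaAlgebra 2) (z : localTowerPointsOfEmb κ (closureEmb (K := ℚ) (v.adicCompletion ℚ)) W →+ ℤ_[2]),
                    q (lambdaSMul κ (closureEmb (K := ℚ) (v.adicCompletion ℚ)) W hg f z) = f • q z) ∧
                  (∀ z, ∃ Ls, IsColemanPair κ (closureEmb (K := ℚ) (v.adicCompletion ℚ)) W 0 g d z Ls (ιP (q z))) ∧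
                  (∀ z Ls Lf, IsColemanPair κ (closureEmb (K := ℚ) (v.adicCompletion ℚ)) W 0 g d z Ls Lf → ιP (q z) = Lf) ∧
                  (∀ z, j (q z) =
                    j₀ (z.comp (AddSubgroup.inclusion (KummerPoint.iSup_signedLocalPoints_le_localTowerPointsOfEmb W 2 κ 1 v)))) ∧
                  (∀ (f : IwasawaAlgebra 2) (y : P), j (f • y) = IwasawaAlgebra.invol 2 f • j y) ∧
                  (∀ x : D.X,
                    (∀ t : signedSelmerInfty W κ 1,
                      resOfLe (W.geomPrimaryTorsion 2) (inf_le_left : κ.kerSubgroup ⊓ decomp v ≤ κ.kerSubgroup)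
                        (t : W.subgroupH1 2 κ.kerSubgroup) = 0 → D.toDual x t = 0) →
                    ∃ y : P, j y = x)) ∧
              -- (RES) the research residue in points currency, for the same `(g, d)`
              (∃ (I : Kato2004.IwasawaH1Data W 2 κ γ)
                  (pair : ∀ n : ℕ, H1 (tateRep W 2) (κ.layerSubgroup n) →ₗ[ℤ_[2]]
                    (localLayerPointsOfEmb κ (closureEmb (K := ℚ) (v.adicCompletion ℚ)) W n →+ ℤ_[2])),
                  -- (P1) projection formula
                  (∀ (n : ℕ) (x : H1 (tateRep W 2) (κ.layerSubgroup (n + 1))) (Q : localPoints W (v.adicCompletion ℚ))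
                    (hQ : Q ∈ localLayerPointsOfEmb κ (closureEmb (K := ℚ) (v.adicCompletion ℚ)) W n),
                    pair n (layerCores (tateRep W 2) κ n x) ⟨Q, hQ⟩ =
                      pair (n + 1) x ⟨Q, localLayerPointsOfEmb_mono κ _ W (Nat.le_succ n) hQ⟩) ∧
                  -- (P2) Galois invariance for `g`
                  (∀ (n : ℕ) (y : H1 (tateRep W 2) (κ.layerSubgroup n)) (Q : localPoints W (v.adicCompletion ℚ))
                    (hQ : Q ∈ localLayerPointsOfEmb κ (closureEmb (K := ℚ) (v.adicCompletion ℚ)) W n),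
                    pair n (conjMap (tateRep W 2).toTopRep (κ.layerSubgroup n)
                        (resGalOfEmb (closureEmb (K := ℚ) (v.adicCompletion ℚ)) g) 1 y)
                      ⟨g • Q, smul_mem_localLayerPointsOfEmb κ _ W n g hQ⟩ = pair n y ⟨Q, hQ⟩) ∧
                  -- (PT) orthogonality up to `2^m` on Kummer witnesses (Poitou–Tate along `ℚ_∞`)
                  (∀ (x : I.H) (s : W.subgroupH1 2 κ.kerSubgroup), s ∈ signedSelmerInfty W κ 1 →
                    ∀ (φ : contOneCocycles (discreteTopRep κ.kerSubgroup (W.geomPrimaryTorsion 2)))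
                      (Q : localPoints W (v.adicCompletion ℚ)) (k : ℕ), oneCocycleClass _ φ = s →
                      2 ^ k • Q ∈ (⨆ n, signedLocalPoints κ (v.adicCompletion ℚ) W 1 n) →
                      (∀ τ : localSubgroupOfEmb κ.kerSubgroup (closureEmb (K := ℚ) (v.adicCompletion ℚ)),
                        pointsMapOfEmb W (closureEmb (K := ℚ) (v.adicCompletion ℚ))
                            ((φ.1 (resGalSubgroupOfEmb κ.kerSubgroup _ τ) : W.geomPrimaryTorsion 2) : W.geomPoints) =
                          (τ : absoluteGaloisGroup (v.adicCompletion ℚ)) • Q - Q) →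
                      ∀ (n : ℕ) (hQn : 2 ^ k • Q ∈ localLayerPointsOfEmb κ (closureEmb (K := ℚ) (v.adicCompletion ℚ)) W n),
                        PadicInt.toZModPow k ((2 : ℤ_[2]) ^ m * pair n (I.proj n x) ⟨2 ^ k • Q, hQn⟩) = 0) ∧
                  -- (ES+Z) a genuine class whose glued functional has a Coleman pair bounded by `L♭` at `𝔭`
                  (∃ (s : I.H) (z : localTowerPointsOfEmb κ (closureEmb (K := ℚ) (v.adicCompletion ℚ)) W →+ ℤ_[2])
                      (Ls Lf : IwasawaAlgebra 2),
                      Kato2004.IsEulerSystemClassTwo W hκ I s ∧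
                      (∀ (n : ℕ) (Q : localPoints W (v.adicCompletion ℚ))
                        (hQ : Q ∈ localLayerPointsOfEmb κ (closureEmb (K := ℚ) (v.adicCompletion ℚ)) W n),
                        z ⟨Q, localLayerPointsOfEmb_le_localTowerPointsOfEmb κ _ W n hQ⟩ = pair n (I.proj n s) ⟨Q, hQ⟩) ∧
                      IsColemanPair κ (closureEmb (K := ℚ) (v.adicCompletion ℚ)) W 0 g d z Ls Lf ∧
                      lengthAt (IwasawaAlgebra 2) (IwasawaAlgebra 2 ⧸ Ideal.span {Lf}) 𝔭 ≤
                        lengthAt (IwasawaAlgebra 2) (IwasawaAlgebra 2 ⧸ Ideal.span {kobayashiL 1 Lplus Lminus}) 𝔭))) :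
    -- the registered stub (R2^ι) `Cruxes.SignedKatoDivisibilityUpToAtTwo.ColemanRat.stub_localRobustPackageTwoInv`, verbatim
    ∀ (v : HeightOneSpectrum (𝓞 ℚ)), ((2 : ℕ) : 𝓞 ℚ) ∈ v.asIdeal →
    ∀ (W : WeierstrassCurve ℚ) [W.IsElliptic] [W.IsGloballyMinimal],
      ¬ W.HasCM → W.analyticRank = 0 → GoodSS W 2 → W.frobeniusTrace 2 = 0 →
      ∀ (κ : ZpExtension ℚ 2) (γ : Field.absoluteGaloisGroup ℚ) (hκ : κ.IsCyclotomic),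
        κ.IsTopGenerator γ → IsCyclotomicVariable 2 γ →
        ∀ [NeZero (W.conductorNorm ℤ)] (f : CuspForm (Gamma0 (W.conductorNorm ℤ)) 2),
          IsNewformOf W f → ∀ (ϖ : ℚ), (ϖ : ℝ) * W.realPeriodRat = plusPeriod f →
        ∀ (Lplus Lminus : IwasawaAlgebra 2), IsPollackPair f 2 Lplus Lminus →
        ∀ (D : SignedSelmerDualData W κ γ 1) [ContinuousSMul ℤ_[2] (W.tateModule 2)]
          [Module.Free ℤ_[2] (W.tateModule 2)] [Module.Finite ℤ_[2] (W.tateModule 2)],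
          Module.IsTorsion (IwasawaAlgebra 2) D.X →
          ∀ 𝔭 : PrimeSpectrum (IwasawaAlgebra 2), 𝔭.asIdeal.height = 1 →
            PowerSeries.C (2 : ℤ_[2]) ∉ 𝔭.asIdeal →
          ∃ (I : Kato2004.IwasawaH1Data W 2 κ γ)
            (P : Type) (_ : AddCommGroup P) (_ : _root_.Module (IwasawaAlgebra 2) P)
            (ι : P →ₗ[IwasawaAlgebra 2] IwasawaAlgebra 2) (col : I.H →ₗ[IwasawaAlgebra 2] P)
            (j : P →+ D.X) (s : I.H) (m : ℕ),
            (∀ (g : IwasawaAlgebra 2) (y : P), j (g • y) = IwasawaAlgebra.invol 2 g • j y) ∧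
            (∀ y, ι y = 0 → (PowerSeries.C (2 : ℤ_[2]) : IwasawaAlgebra 2) ^ m • y = 0) ∧
            (∀ x, (PowerSeries.C (2 : ℤ_[2]) : IwasawaAlgebra 2) ^ m • j (col x) = 0) ∧
            (∀ x : D.X,
              (∀ t : signedSelmerInfty W κ 1,
                resOfLe (W.geomPrimaryTorsion 2) (inf_le_left : κ.kerSubgroup ⊓ decomp v ≤ κ.kerSubgroup)
                  (t : W.subgroupH1 2 κ.kerSubgroup) = 0 → D.toDual x t = 0) →
              ∃ y : P, j y = (PowerSeries.C (2 : ℤ_[2]) : IwasawaAlgebra 2) ^ m • x) ∧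
            Kato2004.IsEulerSystemClassTwo W hκ I s ∧
            lengthAt (IwasawaAlgebra 2) (IwasawaAlgebra 2 ⧸ Ideal.span {ι (col s)}) 𝔭 ≤
              lengthAt (IwasawaAlgebra 2) (IwasawaAlgebra 2 ⧸ Ideal.span {kobayashiL 1 Lplus Lminus}) 𝔭 := by
  intro v hv W _ _ hcm hr hss ha κ γ hκ hγ hcv _ f hf ϖ hϖ Lplus Lminus hPP D _ _ _ hX 𝔭 h𝔭 hp𝔭
  obtain ⟨g, hg, d, j₀, m, hj, ⟨P, _, _, ιP, q, j, hιinj, -, hq, -, hCol, hjq, hjsemi, hcover⟩,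
    ⟨I, pair, hP1, hP2, hPT, s, z, Ls, Lf, hES, hz, hCP, hZ⟩⟩ :=
    H v hv W hcm hr hss ha κ γ hκ hγ hcv f hf ϖ hϖ Lplus Lminus hPP D hX 𝔭 h𝔭 hp𝔭
  -- the glued, `Λ`-compatible `col₀` and the `Λ`-linear `col := q ∘ col₀`
  obtain ⟨col₀, hcol₀, hlayer⟩ := ColGlue.exists_col_linear I _ pair hγ hg hP1 hP2
  obtain ⟨col, hcol⟩ := RecInterface.exists_linearMap_comp_of_lambdaSMul I _ hg q hq col₀ hcol₀
  -- the glued functional of `s` is `col₀ s`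
  have hzs : z = col₀ s := by
    refine AddMonoidHom.ext fun y ↦ ?_
    obtain ⟨n, hn⟩ := exists_mem_localLayerPointsOfEmb_of_mem_localTowerPointsOfEmb κ _ W y.2
    exact (hz n y hn).trans (hlayer n s y hn).symm
  refine ⟨I, P, inferInstance, inferInstance, ιP, col, j, s, m, hjsemi, fun y hy ↦ ?_, fun x ↦ ?_, fun x hx ↦ ?_, hES, ?_⟩
  · -- (Col): `ι_P` is injective, so its kernel is killed by anything
    rw [hιinj (hy.trans (map_zero ιP).symm), smul_zero]
  · -- (Rec): `C(2)^m • j (col x) = 2^m • j₀ ((col₀ x)|_{A⁺}) = 0` by (PT) on Kummer witnesses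
    rw [hcol x, hjq, C_two_pow_smul_eq_nsmul]
    refine RecInterface.pointsModelJ_nsmul_eq_zero_of_forall_witness W 2 κ 1 v D j₀ hv hj _ m
      fun t ht φ Q k hφ hQ hτ ↦ ?_
    obtain ⟨n, hn⟩ := exists_mem_localLayerPointsOfEmb_of_mem_localTowerPointsOfEmb κ _ W
      (KummerPoint.iSup_signedLocalPoints_le_localTowerPointsOfEmb W 2 κ 1 v hQ)
    have hval : ((col₀ x).comp (AddSubgroup.inclusion
        (KummerPoint.iSup_signedLocalPoints_le_localTowerPointsOfEmb W 2 κ 1 v))) ⟨2 ^ k • Q, hQ⟩ =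
        pair n (I.proj n x) ⟨2 ^ k • Q, hn⟩ := by
      rw [AddMonoidHom.comp_apply]
      exact hlayer n x (2 ^ k • Q) hn
    rw [hval]
    exact hPT x t ht φ Q k hφ hQ hτ n hn
  · -- (LocCover) with exponent `m` from exponent `0`: `j (C(2)^m • y) = ι(C(2)^m) • j y = C(2)^m • x`
    obtain ⟨y, hy⟩ := hcover x hx
    exact ⟨(PowerSeries.C (2 : ℤ_[2]) : IwasawaAlgebra 2) ^ m • y, by rw [hjsemi, invol_C_two_pow, hy]⟩
  · -- (Z): `ι_P (col s) = ι_P (q (col₀ s)) = ι_P (q z) = Lf`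
    rw [hcol s, ← hzs, hCol z Ls Lf hCP]
    exact hZ

end SignedKatoOffTwo.PackageOfResidue

end Summit.BirchSwinnertonDyer.BirchSwinnertonDyer.Theorems

end
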